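import Summits.QuantumFields.YangMills.Theorems.AllWindowsColdBoxGaussSideTiltTools
import HarnessLib

/-!
# LINE-17 «hypercontractive second-order tilt expansion» on crux `AllWindowsColdBox.BoxMidWindowsSU22` (stmt-QuantumFields-24003):
# F(iii) of stub F `stub_gaussSideTerms` — the first-order tilt term, abstract engine (STUB-PLAN-E §5 F(iii))

`GaussSideTerms θ` (iii) asks, eventually in `β` and uniformly in `T ≤ ⌈β^θ⌉`, for `|∫ f̃ g̃_T W dν| ≤ K⌈β^θ⌉⁶/β`
(`ν = lineGauss θ β`, `W = centredTilt`, `f̃ = obsF − E_ν obsF`).  Crude Hölder only gives `‖f̃‖₄‖g̃‖₄‖W‖₂ = O(⌈β^θ⌉³/√β)`; the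
rate `1/β` comes from a cancellation.  This file proves the ABSTRACT engine **`abs_integral_centred_mul_mul_tilt_le`**: writing
`f̃ = q̃_f + ũ_f` (`q` = even quadratic surrogate, `u = f − q = −(c + ρ)` small in `L⁴`), `W = V + R'` (`V` = odd cubic chaos,
`R' = W − V` small in `L²`), the five products carrying a `ũ` or an `R'` are `O(⌈β^θ⌉⁶/β)` by three-factor weighted AM–GM with weight
`⌈β^θ⌉⁶/β` (`abs_integral_mul_mul_le_quartic_sq`, `abs_integral_mul_mul_le_sq_quartic`), and the purely quadratic product
`q̃_f q̃_g V` — even·even·odd — has mean zero under `γ` (`integral_gaussD_eq_zero_of_odd`) and is transferred to `ν` at cost `O(1/β)`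
(`eventually_abs_integral_gaussD_sub_lineGauss_le`, `k = 2`, needs eighth moments of `q`).  Plus: centred-moment glue
(`integral_centred_pow_four_le`, `integral_centred_sq_le`, `integral_sub_const_pow_eight_le`), the threshold `eventually_ceil_pow_le`
(`⌈β^θ⌉⁶ ≤ β²`, `⌈β^θ⌉⁸ ≤ β⁴`) and the real bookkeeping `tilt_bookkeeping`.  The instantiation (obsF/obsG, `qObsD`, E(0) local terms,
`tiltCubicW`, `tiltWE` with the E(4) dominators) lives with the F assembly.

No definition; standard axioms.  HONEST LABEL: a helper toward one third of the OPEN registered stub F of one critic-PASSed line on the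
R2ξ″ RECORD-rung crux 24003; no stub by name, no crux, rung or summit; the Yang–Mills mass gap is NOT proved by this file.
-/

set_option autoImplicit false

noncomputable section

open MeasureTheory ProbabilityTheory Finset
open Literature.MathematicalPhysics.QuantumLattice
open Literature.MathematicalPhysics.QuantumFieldTheory
open Literature.MathematicalPhysics.QuantumFieldTheory.LatticeMaxwell
open Summit.QuantumFields.YangMills.Theorems.WeakCouplingRates
open Summit.QuantumFields.YangMills.Theorems.ColdBoxAllGroups
open Summit.QuantumFields.YangMills.Theorems.FreeEnergyLogCoefficient

namespace Summit.QuantumFields.YangMills.Theorems.AllWindowsColdBoxBoxMidLine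

section TiltEngine

/-- **The abstract first-order tilt estimate of F(iii)** (`0 < θ ≤ 1/16`, eventually in `β`; `Hr = ⌈β^θ⌉`, `γ = gaussD`,
`ν = lineGauss θ β`).  For two bounded observables `f, g` with centred fourth `ν`-moments `≤ F4`, decomposing on the event as
`q − c − ρ` (`|ρ| ≤ r`; `q` even with `∫q⁴dγ ≤ A4`, `∫q⁸dγ ≤ A8`; `∫c⁴dγ ≤ Cc4·Hr⁶/β²`; `∫r⁴dγ ≤ Cr4·Hr⁸/β⁴`), an odd `V`
(`∫V⁴dγ ≤ CV·Hr¹²/β²`, `∫V⁴dγ ≤ 1`, `∫V²dγ ≤ 1`) and a measurable `T` with `|T − V| ≤ X` on the event (`∫X²dγ ≤ CX·Hr¹²/β²`):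
`|∫ f̃ g̃ (T − E_ν T) dν| ≤ K·Hr⁶/β` (`f̃ = f − E_ν f`), `K` explicit in the constants.  Mechanism: `f̃ = q̃ + ũ`, `T̃ = V + R'`;
the five terms carrying a `ũ` or an `R'` are small by three-factor weighted AM–GM (weight `Hr⁶/β`), and the purely quadratic term
`∫ q̃_f q̃_g V dν` vanishes under `γ` by parity (even·even·odd) and is transferred to `ν` at cost `O(1/β)`. -/
theorem abs_integral_centred_mul_mul_tilt_le {θ : ℝ} (hθ : 0 < θ) (hθ16 : θ ≤ 1 / 16) {F4 A4 A8 Cc4 Cr4 CV CX : ℝ}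
    (hA4 : 0 ≤ A4) (hA8 : 0 ≤ A8) (hCc4 : 0 ≤ Cc4) (hCr4 : 0 ≤ Cr4) :
    ∃ β₀ : ℝ, ∀ β : ℝ, β₀ ≤ β → ∀ (B : ℝ) (f g qf qg cf cg rf rg V T X : TSpaceD ⌈β ^ θ⌉₊ (dimE ρ₂) → ℝ),
      Measurable f → Measurable g → (∀ t, |f t| ≤ B) → (∀ t, |g t| ≤ B) →
      ∫ t, (f t - ∫ s, f s ∂(lineGauss θ β)) ^ 4 ∂(lineGauss θ β) ≤ F4 →
      ∫ t, (g t - ∫ s, g s ∂(lineGauss θ β)) ^ 4 ∂(lineGauss θ β) ≤ F4 →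
      Measurable qf → Measurable qg → (∀ t, qf (-t) = qf t) → (∀ t, qg (-t) = qg t) →
      Integrable (fun t => qf t ^ 4) (gaussD ⌈β ^ θ⌉₊ (dimE ρ₂)) → Integrable (fun t => qg t ^ 4) (gaussD ⌈β ^ θ⌉₊ (dimE ρ₂)) →
      ∫ t, qf t ^ 4 ∂(gaussD ⌈β ^ θ⌉₊ (dimE ρ₂)) ≤ A4 → ∫ t, qg t ^ 4 ∂(gaussD ⌈β ^ θ⌉₊ (dimE ρ₂)) ≤ A4 →
      Integrable (fun t => qf t ^ 8) (gaussD ⌈β ^ θ⌉₊ (dimE ρ₂)) → Integrable (fun t => qg t ^ 8) (gaussD ⌈β ^ θ⌉₊ (dimE ρ₂)) →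
      ∫ t, qf t ^ 8 ∂(gaussD ⌈β ^ θ⌉₊ (dimE ρ₂)) ≤ A8 → ∫ t, qg t ^ 8 ∂(gaussD ⌈β ^ θ⌉₊ (dimE ρ₂)) ≤ A8 →
      Integrable (fun t => cf t ^ 4) (gaussD ⌈β ^ θ⌉₊ (dimE ρ₂)) → Integrable (fun t => cg t ^ 4) (gaussD ⌈β ^ θ⌉₊ (dimE ρ₂)) →
      ∫ t, cf t ^ 4 ∂(gaussD ⌈β ^ θ⌉₊ (dimE ρ₂)) ≤ Cc4 * (⌈β ^ θ⌉₊ : ℝ) ^ 6 / β ^ 2 →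
      ∫ t, cg t ^ 4 ∂(gaussD ⌈β ^ θ⌉₊ (dimE ρ₂)) ≤ Cc4 * (⌈β ^ θ⌉₊ : ℝ) ^ 6 / β ^ 2 →
      Integrable (fun t => rf t ^ 4) (gaussD ⌈β ^ θ⌉₊ (dimE ρ₂)) → Integrable (fun t => rg t ^ 4) (gaussD ⌈β ^ θ⌉₊ (dimE ρ₂)) →
      ∫ t, rf t ^ 4 ∂(gaussD ⌈β ^ θ⌉₊ (dimE ρ₂)) ≤ Cr4 * (⌈β ^ θ⌉₊ : ℝ) ^ 8 / β ^ 4 →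
      ∫ t, rg t ^ 4 ∂(gaussD ⌈β ^ θ⌉₊ (dimE ρ₂)) ≤ Cr4 * (⌈β ^ θ⌉₊ : ℝ) ^ 8 / β ^ 4 →
      (∀ t ∈ lineEvent θ β, |qf t - f t - cf t| ≤ rf t) → (∀ t ∈ lineEvent θ β, |qg t - g t - cg t| ≤ rg t) →
      Measurable V → (∀ t, V (-t) = -V t) → Integrable (fun t => V t ^ 4) (gaussD ⌈β ^ θ⌉₊ (dimE ρ₂)) →
      ∫ t, V t ^ 4 ∂(gaussD ⌈β ^ θ⌉₊ (dimE ρ₂)) ≤ CV * (⌈β ^ θ⌉₊ : ℝ) ^ 12 / β ^ 2 →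
      ∫ t, V t ^ 4 ∂(gaussD ⌈β ^ θ⌉₊ (dimE ρ₂)) ≤ 1 → ∫ t, V t ^ 2 ∂(gaussD ⌈β ^ θ⌉₊ (dimE ρ₂)) ≤ 1 →
      Measurable T → AEStronglyMeasurable X (gaussD ⌈β ^ θ⌉₊ (dimE ρ₂)) → Integrable (fun t => X t ^ 2) (gaussD ⌈β ^ θ⌉₊ (dimE ρ₂)) →
      ∫ t, X t ^ 2 ∂(gaussD ⌈β ^ θ⌉₊ (dimE ρ₂)) ≤ CX * (⌈β ^ θ⌉₊ : ℝ) ^ 12 / β ^ 2 →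
      (∀ t ∈ lineEvent θ β, |T t - V t| ≤ X t) →
      |∫ t, (f t - ∫ s, f s ∂(lineGauss θ β)) * (g t - ∫ s, g s ∂(lineGauss θ β)) * (T t - ∫ s, T s ∂(lineGauss θ β))
          ∂(lineGauss θ β)| ≤
        ((1 + F4) / 4 + (1 + A4) / 2 + 2 * (CV / 2 + 64 * (Cc4 + Cr4)) + (F4 + 256 * (Cc4 + Cr4)) / 4 +
          (32 * A4 + 256 * (Cc4 + Cr4)) / 4 + 16 * A4 + 3 * (2 * CX + 16) + (3 + 2 ^ 7 * (A8 + (1 + A4) ^ 4))) *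
          ((⌈β ^ θ⌉₊ : ℝ) ^ 6 / β) := by
  obtain ⟨β₁, hpack⟩ := eventually_lineGauss_package hθ hθ16 (k := 1) le_rfl
  obtain ⟨β₂, htr⟩ := eventually_abs_integral_gaussD_sub_lineGauss_le hθ hθ16 (k := 2) (by norm_num)
  obtain ⟨β₃, hceil⟩ := eventually_ceil_pow_le hθ hθ16
  refine ⟨max (max β₁ β₂) β₃, fun β hβ B f g qf qg cf cg rf rg V T X hfm hgm hfb hgb hF4f hF4g hqfm hqgm hqfe hqge hqf4 hqg4 hqf4le
    hqg4le hqf8 hqg8 hqf8le hqg8le hcf4 hcg4 hcf4le hcg4le hrf4 hrg4 hrf4le hrg4le hdf hdg hVm hVo hV4 hV4le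
    hV41 hV21 hTm hXm hX2 hX2le hTV => ?_⟩
  obtain ⟨hβ1, hνP, hγS, -, -, hhalf⟩ := hpack β (le_trans (le_max_left _ _) ((le_max_left _ _).trans hβ))
  have hβ₂ : β₂ ≤ β := le_trans (le_max_right _ _) ((le_max_left _ _).trans hβ)
  obtain ⟨h62, h84⟩ := hceil β ((le_max_right _ _).trans hβ)
  have hβ0 : 0 < β := by linarith
  have hHr : (1 : ℝ) ≤ (⌈β ^ θ⌉₊ : ℝ) := (one_le_ceil_rpow_and_le hβ1 hθ.le).1
  have hL0 : 0 < (⌈β ^ θ⌉₊ : ℝ) ^ 6 / β := by positivity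
  haveI : IsProbabilityMeasure (gaussD ⌈β ^ θ⌉₊ (dimE ρ₂)) := isProbabilityMeasure_gaussD _ _
  haveI : IsProbabilityMeasure (lineGauss θ β) := hνP
  have hsq : Real.sqrt (1 / β ^ 2) = 1 / β := by
    rw [show (1 : ℝ) / β ^ 2 = (1 / β) ^ 2 by ring]; exact Real.sqrt_sq (by positivity)
  have e4 : Even 4 := by decide
  have haeE : ∀ᵐ t ∂(lineGauss θ β), t ∈ lineEvent θ β := ae_mem_lineEvent θ β
  -- ===== the centred observables `f̃, g̃` (bounded)
  obtain ⟨ft, hft⟩ : ∃ φ : TSpaceD ⌈β ^ θ⌉₊ (dimE ρ₂) → ℝ, φ = fun t => f t - ∫ s, f s ∂(lineGauss θ β) := ⟨_, rfl⟩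
  obtain ⟨gt, hgt⟩ : ∃ φ : TSpaceD ⌈β ^ θ⌉₊ (dimE ρ₂) → ℝ, φ = fun t => g t - ∫ s, g s ∂(lineGauss θ β) := ⟨_, rfl⟩
  have hftm : Measurable ft := by rw [hft]; exact hfm.sub measurable_const
  have hgtm : Measurable gt := by rw [hgt]; exact hgm.sub measurable_const
  have hft4 : Integrable (fun t => ft t ^ 4) (lineGauss θ β) := by
    refine Integrable.of_bound (hftm.pow_const 4).aestronglyMeasurable ((B + |∫ s, f s ∂(lineGauss θ β)|) ^ 4)
      (ae_of_all _ fun t => ?_)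
    rw [Real.norm_eq_abs, abs_pow, hft]
    beta_reduce
    have h1 : |f t - ∫ s, f s ∂(lineGauss θ β)| ≤ B + |∫ s, f s ∂(lineGauss θ β)| :=
      (abs_sub _ _).trans (add_le_add (hfb t) le_rfl)
    exact pow_le_pow_left₀ (abs_nonneg _) h1 4
  have hgt4 : Integrable (fun t => gt t ^ 4) (lineGauss θ β) := by
    refine Integrable.of_bound (hgtm.pow_const 4).aestronglyMeasurable ((B + |∫ s, g s ∂(lineGauss θ β)|) ^ 4)
      (ae_of_all _ fun t => ?_)
    rw [Real.norm_eq_abs, abs_pow, hgt]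
    beta_reduce
    have h1 : |g t - ∫ s, g s ∂(lineGauss θ β)| ≤ B + |∫ s, g s ∂(lineGauss θ β)| :=
      (abs_sub _ _).trans (add_le_add (hgb t) le_rfl)
    exact pow_le_pow_left₀ (abs_nonneg _) h1 4
  obtain ⟨hft2, hFf2⟩ := memLp_two_of_integrable_pow_four hftm.aestronglyMeasurable hft4
  obtain ⟨hgt2, -⟩ := memLp_two_of_integrable_pow_four hgtm.aestronglyMeasurable hgt4
  have hFf4 : ∫ t, ft t ^ 4 ∂(lineGauss θ β) ≤ F4 := by rw [hft]; exact hF4f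
  -- ===== the centred quadratic surrogates `q̃`
  have hqf4ν : Integrable (fun t => qf t ^ 4) (lineGauss θ β) := integrable_cond_of_integrable hγS hqf4
  have hqg4ν : Integrable (fun t => qg t ^ 4) (lineGauss θ β) := integrable_cond_of_integrable hγS hqg4
  have hPf4 : ∫ t, qf t ^ 4 ∂(lineGauss θ β) ≤ 2 * A4 :=
    (integral_cond_le_two_mul hhalf (ae_of_all _ fun t => e4.pow_nonneg _) hqf4).trans (by linarith only [hqf4le])
  have hPg4 : ∫ t, qg t ^ 4 ∂(lineGauss θ β) ≤ 2 * A4 :=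
    (integral_cond_le_two_mul hhalf (ae_of_all _ fun t => e4.pow_nonneg _) hqg4).trans (by linarith only [hqg4le])
  obtain ⟨hqf2γ, hqf2le⟩ := memLp_two_of_integrable_pow_four hqfm.aestronglyMeasurable hqf4
  obtain ⟨hqg2γ, hqg2le⟩ := memLp_two_of_integrable_pow_four hqgm.aestronglyMeasurable hqg4
  have hqf2ν : MemLp qf 2 (lineGauss θ β) := memLp_cond_of_memLp hγS hqf2γ
  have hqg2ν : MemLp qg 2 (lineGauss θ β) := memLp_cond_of_memLp hγS hqg2γ
  have hqf2νle : ∫ t, qf t ^ 2 ∂(lineGauss θ β) ≤ 1 + A4 :=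
    (integral_cond_le_two_mul hhalf (ae_of_all _ fun t => sq_nonneg _) hqf2γ.integrable_sq).trans (by linarith only [hqf2le, hqf4le])
  have hqg2νle : ∫ t, qg t ^ 2 ∂(lineGauss θ β) ≤ 1 + A4 :=
    (integral_cond_le_two_mul hhalf (ae_of_all _ fun t => sq_nonneg _) hqg2γ.integrable_sq).trans (by linarith only [hqg2le, hqg4le])
  obtain ⟨qft, hqft⟩ : ∃ φ : TSpaceD ⌈β ^ θ⌉₊ (dimE ρ₂) → ℝ, φ = fun t => qf t - ∫ s, qf s ∂(lineGauss θ β) := ⟨_, rfl⟩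
  obtain ⟨qgt, hqgt⟩ : ∃ φ : TSpaceD ⌈β ^ θ⌉₊ (dimE ρ₂) → ℝ, φ = fun t => qg t - ∫ s, qg s ∂(lineGauss θ β) := ⟨_, rfl⟩
  have hqftm : Measurable qft := by rw [hqft]; exact hqfm.sub measurable_const
  have hqgtm : Measurable qgt := by rw [hqgt]; exact hqgm.sub measurable_const
  have hcqf := integral_centred_pow_four_le (μ := lineGauss θ β) hqfm.aestronglyMeasurable hqf4ν
  have hcqg := integral_centred_pow_four_le (μ := lineGauss θ β) hqgm.aestronglyMeasurable hqg4ν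
  have hqft4 : Integrable (fun t => qft t ^ 4) (lineGauss θ β) := by rw [hqft]; exact hcqf.1
  have hqgt4 : Integrable (fun t => qgt t ^ 4) (lineGauss θ β) := by rw [hqgt]; exact hcqg.1
  have hQf4 : ∫ t, qft t ^ 4 ∂(lineGauss θ β) ≤ 16 * ∫ t, qf t ^ 4 ∂(lineGauss θ β) := by rw [hqft]; exact hcqf.2
  have hQg4 : ∫ t, qgt t ^ 4 ∂(lineGauss θ β) ≤ 16 * ∫ t, qg t ^ 4 ∂(lineGauss θ β) := by rw [hqgt]; exact hcqg.2
  have hqgt2m : MemLp qgt 2 (lineGauss θ β) := by rw [hqgt]; exact hqg2ν.sub (memLp_const _)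
  have hqft2m : MemLp qft 2 (lineGauss θ β) := by rw [hqft]; exact hqf2ν.sub (memLp_const _)
  have hQg2 : ∫ t, qgt t ^ 2 ∂(lineGauss θ β) ≤ 1 + A4 := by
    rw [hqgt]; exact (integral_centred_sq_le hqg2ν).trans hqg2νle
  -- ===== the centred local corrections `ũ = f̃ − q̃`
  obtain ⟨uft, huft⟩ : ∃ φ : TSpaceD ⌈β ^ θ⌉₊ (dimE ρ₂) → ℝ, φ = fun t => ft t - qft t := ⟨_, rfl⟩
  obtain ⟨ugt, hugt⟩ : ∃ φ : TSpaceD ⌈β ^ θ⌉₊ (dimE ρ₂) → ℝ, φ = fun t => gt t - qgt t := ⟨_, rfl⟩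
  have huftm : Measurable uft := by rw [huft]; exact hftm.sub hqftm
  have hugtm : Measurable ugt := by rw [hugt]; exact hgtm.sub hqgtm
  have hfν : Integrable f (lineGauss θ β) :=
    Integrable.of_bound hfm.aestronglyMeasurable B (ae_of_all _ fun t => by rw [Real.norm_eq_abs]; exact hfb t)
  have hgν : Integrable g (lineGauss θ β) :=
    Integrable.of_bound hgm.aestronglyMeasurable B (ae_of_all _ fun t => by rw [Real.norm_eq_abs]; exact hgb t)
  have hqfν : Integrable qf (lineGauss θ β) := hqf2ν.integrable one_le_two
  have hqgν : Integrable qg (lineGauss θ β) := hqg2ν.integrable one_le_two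
  -- `ũ` is the centring of `u = f − q`
  have huf_eq : uft = fun t => (f t - qf t) - ∫ s, (f s - qf s) ∂(lineGauss θ β) := by
    funext t; rw [huft, hft, hqft, integral_sub hfν hqfν]; ring
  have hug_eq : ugt = fun t => (g t - qg t) - ∫ s, (g s - qg s) ∂(lineGauss θ β) := by
    funext t; rw [hugt, hgt, hqgt, integral_sub hgν hqgν]; ring
  -- `∫ u⁴ dν ≤ 8 (∫ c⁴ dν + ∫ r⁴ dν)` (E(0) decomposition on the event)
  have hcf4ν : Integrable (fun t => cf t ^ 4) (lineGauss θ β) := integrable_cond_of_integrable hγS hcf4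
  have hcg4ν : Integrable (fun t => cg t ^ 4) (lineGauss θ β) := integrable_cond_of_integrable hγS hcg4
  have hrf4ν : Integrable (fun t => rf t ^ 4) (lineGauss θ β) := integrable_cond_of_integrable hγS hrf4
  have hrg4ν : Integrable (fun t => rg t ^ 4) (lineGauss θ β) := integrable_cond_of_integrable hγS hrg4
  have hCcf : ∫ t, cf t ^ 4 ∂(lineGauss θ β) ≤ 2 * (Cc4 * (⌈β ^ θ⌉₊ : ℝ) ^ 6 / β ^ 2) :=
    (integral_cond_le_two_mul hhalf (ae_of_all _ fun t => e4.pow_nonneg _) hcf4).trans (by linarith only [hcf4le])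
  have hCcg : ∫ t, cg t ^ 4 ∂(lineGauss θ β) ≤ 2 * (Cc4 * (⌈β ^ θ⌉₊ : ℝ) ^ 6 / β ^ 2) :=
    (integral_cond_le_two_mul hhalf (ae_of_all _ fun t => e4.pow_nonneg _) hcg4).trans (by linarith only [hcg4le])
  have hCrf : ∫ t, rf t ^ 4 ∂(lineGauss θ β) ≤ 2 * (Cr4 * (⌈β ^ θ⌉₊ : ℝ) ^ 8 / β ^ 4) :=
    (integral_cond_le_two_mul hhalf (ae_of_all _ fun t => e4.pow_nonneg _) hrf4).trans (by linarith only [hrf4le])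
  have hCrg : ∫ t, rg t ^ 4 ∂(lineGauss θ β) ≤ 2 * (Cr4 * (⌈β ^ θ⌉₊ : ℝ) ^ 8 / β ^ 4) :=
    (integral_cond_le_two_mul hhalf (ae_of_all _ fun t => e4.pow_nonneg _) hrg4).trans (by linarith only [hrg4le])
  have hu4 : ∀ {p q c r : TSpaceD ⌈β ^ θ⌉₊ (dimE ρ₂) → ℝ}, Measurable p → Measurable q → (∀ t, |p t| ≤ B) →
      Integrable (fun t => q t ^ 4) (lineGauss θ β) → Integrable (fun t => c t ^ 4) (lineGauss θ β) →
      Integrable (fun t => r t ^ 4) (lineGauss θ β) → (∀ t ∈ lineEvent θ β, |q t - p t - c t| ≤ r t) →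
      Integrable (fun t => (p t - q t) ^ 4) (lineGauss θ β) ∧
      ∫ t, (p t - q t) ^ 4 ∂(lineGauss θ β) ≤ 8 * ((∫ t, c t ^ 4 ∂(lineGauss θ β)) + ∫ t, r t ^ 4 ∂(lineGauss θ β)) := by
    intro p q c r hpm hqm hpb hq4 hc4 hr4 hdec
    have hp4 : Integrable (fun t => p t ^ 4) (lineGauss θ β) :=
      Integrable.of_bound (hpm.pow_const 4).aestronglyMeasurable (B ^ 4) (ae_of_all _ fun t => by
        rw [Real.norm_eq_abs, abs_pow]; exact pow_le_pow_left₀ (abs_nonneg _) (hpb t) 4)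
    have hS : Integrable (fun t => p t ^ 4 + q t ^ 4) (lineGauss θ β) := hp4.add hq4
    have hI : Integrable (fun t => (p t - q t) ^ 4) (lineGauss θ β) :=
      (hS.const_mul 8).mono' ((hpm.sub hqm).pow_const 4).aestronglyMeasurable (ae_of_all _ fun t => by
        rw [Real.norm_eq_abs, abs_of_nonneg (e4.pow_nonneg _)]
        exact Literature.Analysis.FunctionSpaces.pow_four_sub_le _ _)
    have hR0 : Integrable (fun t => c t ^ 4 + r t ^ 4) (lineGauss θ β) := hc4.add hr4
    have hR : Integrable (fun t => 8 * (c t ^ 4 + r t ^ 4)) (lineGauss θ β) := hR0.const_mul 8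
    refine ⟨hI, (integral_mono_ae hI hR (haeE.mono fun t ht => ?_)).trans (le_of_eq ?_)⟩
    · have hw := hdec t ht
      have h1 : (-(q t - p t - c t)) ^ 4 ≤ r t ^ 4 := by
        rw [← e4.pow_abs, abs_neg]; exact pow_le_pow_left₀ (abs_nonneg _) hw 4
      calc (p t - q t) ^ 4 = (c t - (-(q t - p t - c t))) ^ 4 := by ring
        _ ≤ 8 * (c t ^ 4 + (-(q t - p t - c t)) ^ 4) := Literature.Analysis.FunctionSpaces.pow_four_sub_le _ _
        _ ≤ 8 * (c t ^ 4 + r t ^ 4) := by linarith only [h1]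
    · rw [integral_const_mul, integral_add hc4 hr4]
  obtain ⟨hufI, hNf4⟩ := hu4 hfm hqfm hfb hqf4ν hcf4ν hrf4ν hdf
  obtain ⟨hugI, hNg4⟩ := hu4 hgm hqgm hgb hqg4ν hcg4ν hrg4ν hdg
  have hcuf := integral_centred_pow_four_le (μ := lineGauss θ β) ((hfm.sub hqfm).aestronglyMeasurable) hufI
  have hcug := integral_centred_pow_four_le (μ := lineGauss θ β) ((hgm.sub hqgm).aestronglyMeasurable) hugI
  have huft4 : Integrable (fun t => uft t ^ 4) (lineGauss θ β) := by rw [huf_eq]; exact hcuf.1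
  have hugt4 : Integrable (fun t => ugt t ^ 4) (lineGauss θ β) := by rw [hug_eq]; exact hcug.1
  have hUf4 : ∫ t, uft t ^ 4 ∂(lineGauss θ β) ≤ 16 * ∫ t, (f t - qf t) ^ 4 ∂(lineGauss θ β) := by rw [huf_eq]; exact hcuf.2
  have hUg4 : ∫ t, ugt t ^ 4 ∂(lineGauss θ β) ≤ 16 * ∫ t, (g t - qg t) ^ 4 ∂(lineGauss θ β) := by rw [hug_eq]; exact hcug.2
  obtain ⟨huft2, -⟩ := memLp_two_of_integrable_pow_four huftm.aestronglyMeasurable huft4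
  obtain ⟨hugt2, -⟩ := memLp_two_of_integrable_pow_four hugtm.aestronglyMeasurable hugt4
  -- ===== the cubic chaos `V`
  have hV4ν : Integrable (fun t => V t ^ 4) (lineGauss θ β) := integrable_cond_of_integrable hγS hV4
  have hV4νle : ∫ t, V t ^ 4 ∂(lineGauss θ β) ≤ 2 * (CV * (⌈β ^ θ⌉₊ : ℝ) ^ 12 / β ^ 2) :=
    (integral_cond_le_two_mul hhalf (ae_of_all _ fun t => e4.pow_nonneg _) hV4).trans (by linarith only [hV4le])
  obtain ⟨hV2γ, -⟩ := memLp_two_of_integrable_pow_four hVm.aestronglyMeasurable hV4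
  have hV2ν : MemLp V 2 (lineGauss θ β) := memLp_cond_of_memLp hγS hV2γ
  have hVν : Integrable V (lineGauss θ β) := hV2ν.integrable one_le_two
  have hEV : |∫ t, V t ∂(lineGauss θ β)| ≤ 4 * (1 / β) := by
    have h := htr β hβ₂ V hV2γ
    rw [hsq, integral_gaussD_eq_zero_of_odd _ _ hVo, zero_sub, abs_neg] at h
    refine h.trans ?_
    have : 2 * (1 + ∫ t, V t ^ 2 ∂(gaussD ⌈β ^ θ⌉₊ (dimE ρ₂))) ≤ 4 := by linarith only [hV21]
    exact mul_le_mul_of_nonneg_right this (by positivity)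
  have hEV2 : (∫ t, V t ∂(lineGauss θ β)) ^ 2 ≤ 16 / β ^ 2 := by
    rw [← sq_abs, show (16 : ℝ) / β ^ 2 = (4 * (1 / β)) ^ 2 by field_simp; norm_num]
    exact pow_le_pow_left₀ (abs_nonneg _) hEV 2
  -- ===== the tilt `T = V + d`, `|d| ≤ X` on the event; `R' = T̃ − V`
  obtain ⟨d, hd⟩ : ∃ φ : TSpaceD ⌈β ^ θ⌉₊ (dimE ρ₂) → ℝ, φ = fun t => T t - V t := ⟨_, rfl⟩
  have hdm : Measurable d := by rw [hd]; exact hTm.sub hVm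
  have hX2ν : Integrable (fun t => X t ^ 2) (lineGauss θ β) := integrable_cond_of_integrable hγS hX2
  have hdX : ∀ᵐ t ∂(lineGauss θ β), |d t| ≤ X t := haeE.mono fun t ht => by rw [hd]; exact hTV t ht
  have hd2 : Integrable (fun t => d t ^ 2) (lineGauss θ β) :=
    hX2ν.mono' (hdm.pow_const 2).aestronglyMeasurable (hdX.mono fun t ht => by
      rw [Real.norm_eq_abs, abs_of_nonneg (sq_nonneg _), ← sq_abs]
      exact pow_le_pow_left₀ (abs_nonneg _) ht 2)
  have hd2m : MemLp d 2 (lineGauss θ β) := (memLp_two_iff_integrable_sq hdm.aestronglyMeasurable).2 hd2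
  have hD2 : ∫ t, d t ^ 2 ∂(lineGauss θ β) ≤ 2 * (CX * (⌈β ^ θ⌉₊ : ℝ) ^ 12 / β ^ 2) := by
    have h1 := integral_sq_le_of_abs_le_ae hd2m hX2ν hdX
    have h2 := integral_cond_le_two_mul hhalf (ae_of_all _ fun t => sq_nonneg (X t)) hX2
    exact h1.trans (h2.trans (by linarith only [hX2le]))
  have hdν : Integrable d (lineGauss θ β) := hd2m.integrable one_le_two
  have hET : ∫ t, T t ∂(lineGauss θ β) = (∫ t, d t ∂(lineGauss θ β)) + ∫ t, V t ∂(lineGauss θ β) := by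
    rw [← integral_add hdν hVν]; refine integral_congr_ae (ae_of_all _ fun t => ?_); rw [hd]; ring
  obtain ⟨Rp, hRp⟩ : ∃ φ : TSpaceD ⌈β ^ θ⌉₊ (dimE ρ₂) → ℝ, φ = fun t => (T t - ∫ s, T s ∂(lineGauss θ β)) - V t := ⟨_, rfl⟩
  have hRp_eq : Rp = fun t => (d t - ∫ s, d s ∂(lineGauss θ β)) - ∫ s, V s ∂(lineGauss θ β) := by
    funext t; rw [hRp, hET, hd]; ring
  have hRpm : Measurable Rp := by rw [hRp]; exact (hTm.sub measurable_const).sub hVm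
  have hRp2m : MemLp Rp 2 (lineGauss θ β) := by rw [hRp_eq]; exact (hd2m.sub (memLp_const _)).sub (memLp_const _)
  have hRp2 : Integrable (fun t => Rp t ^ 2) (lineGauss θ β) := hRp2m.integrable_sq
  have hR2 : ∫ t, Rp t ^ 2 ∂(lineGauss θ β) ≤ 2 * (∫ t, d t ^ 2 ∂(lineGauss θ β)) + 2 * (∫ t, V t ∂(lineGauss θ β)) ^ 2 := by
    have h1 := integral_sub_sq_le_two_mul (μ := lineGauss θ β) (X := fun t => d t - ∫ s, d s ∂(lineGauss θ β))
      (Y := fun _ => ∫ s, V s ∂(lineGauss θ β)) (hd2m.sub (memLp_const _)) (memLp_const _)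
    have h1' : ∫ t, Rp t ^ 2 ∂(lineGauss θ β) ≤ 2 * ((∫ t, (d t - ∫ s, d s ∂(lineGauss θ β)) ^ 2 ∂(lineGauss θ β)) +
        ∫ _t, (∫ s, V s ∂(lineGauss θ β)) ^ 2 ∂(lineGauss θ β)) := by rw [hRp_eq]; exact h1
    rw [integral_const, probReal_univ, one_smul] at h1'
    have h3 := integral_centred_sq_le hd2m
    linarith only [h1', h3]
  -- ===== the six products and the split of `∫ f̃ g̃ T̃`
  have hI1 := integrable_mul_mul_of_quartic_sq hftm.aestronglyMeasurable hVm.aestronglyMeasurable hugtm.aestronglyMeasurable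
    hft4 hV4ν hugt2.integrable_sq
  have hI2 := integrable_mul_mul_of_quartic_sq hftm.aestronglyMeasurable hugtm.aestronglyMeasurable hRpm.aestronglyMeasurable
    hft4 hugt4 hRp2
  have hI3 := integrable_mul_mul_of_quartic_sq hqgtm.aestronglyMeasurable hVm.aestronglyMeasurable huftm.aestronglyMeasurable
    hqgt4 hV4ν huft2.integrable_sq
  have hI4 := integrable_mul_mul_of_quartic_sq hqgtm.aestronglyMeasurable huftm.aestronglyMeasurable hRpm.aestronglyMeasurable
    hqgt4 huft4 hRp2
  have hI5 := integrable_mul_mul_of_quartic_sq hqftm.aestronglyMeasurable hqgtm.aestronglyMeasurable hRpm.aestronglyMeasurable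
    hqft4 hqgt4 hRp2
  have hI6 := integrable_mul_mul_of_quartic_sq hqftm.aestronglyMeasurable hqgtm.aestronglyMeasurable hVm.aestronglyMeasurable
    hqft4 hqgt4 hV2ν.integrable_sq
  have hsplit : ∫ t, (f t - ∫ s, f s ∂(lineGauss θ β)) * (g t - ∫ s, g s ∂(lineGauss θ β)) * (T t - ∫ s, T s ∂(lineGauss θ β))
      ∂(lineGauss θ β) =
      (∫ t, ft t * V t * ugt t ∂(lineGauss θ β)) + (∫ t, ft t * ugt t * Rp t ∂(lineGauss θ β)) +
      (∫ t, qgt t * V t * uft t ∂(lineGauss θ β)) + (∫ t, qgt t * uft t * Rp t ∂(lineGauss θ β)) +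
      (∫ t, qft t * qgt t * Rp t ∂(lineGauss θ β)) + (∫ t, qft t * qgt t * V t ∂(lineGauss θ β)) := by
    have h12 : Integrable (fun t => ft t * V t * ugt t + ft t * ugt t * Rp t) (lineGauss θ β) := hI1.add hI2
    have h123 : Integrable (fun t => ft t * V t * ugt t + ft t * ugt t * Rp t + qgt t * V t * uft t) (lineGauss θ β) := h12.add hI3
    have h1234 : Integrable (fun t => ft t * V t * ugt t + ft t * ugt t * Rp t + qgt t * V t * uft t + qgt t * uft t * Rp t)
        (lineGauss θ β) := h123.add hI4
    have h12345 : Integrable (fun t => ft t * V t * ugt t + ft t * ugt t * Rp t + qgt t * V t * uft t + qgt t * uft t * Rp t +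
        qft t * qgt t * Rp t) (lineGauss θ β) := h1234.add hI5
    rw [← integral_add hI1 hI2, ← integral_add h12 hI3, ← integral_add h123 hI4, ← integral_add h1234 hI5, ← integral_add h12345 hI6]
    refine integral_congr_ae (ae_of_all _ fun t => ?_)
    have e1 : f t - ∫ s, f s ∂(lineGauss θ β) = ft t := by rw [hft]
    have e2 : g t - ∫ s, g s ∂(lineGauss θ β) = gt t := by rw [hgt]
    have e3 : T t - ∫ s, T s ∂(lineGauss θ β) = V t + Rp t := by rw [hRp]; ring
    have e4' : uft t = ft t - qft t := by rw [huft]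
    have e5 : ugt t = gt t - qgt t := by rw [hugt]
    beta_reduce
    rw [e1, e2, e3, e4', e5]; ring
  -- ===== T1 … T5: three-factor weighted AM–GM with weight `L = Hr⁶/β`
  have t1 := abs_integral_mul_mul_le_sq_quartic (μ := lineGauss θ β) (A := ft) (B := V) (C := ugt) hft2.integrable_sq hV4ν hugt4 hL0
  have t2 := abs_integral_mul_mul_le_quartic_sq (μ := lineGauss θ β) (A := ft) (B := ugt) (C := Rp) hft4 hugt4 hRp2 hL0
  have t3 := abs_integral_mul_mul_le_sq_quartic (μ := lineGauss θ β) (A := qgt) (B := V) (C := uft) hqgt2m.integrable_sq hV4ν huft4 hL0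
  have t4 := abs_integral_mul_mul_le_quartic_sq (μ := lineGauss θ β) (A := qgt) (B := uft) (C := Rp) hqgt4 huft4 hRp2 hL0
  have t5 := abs_integral_mul_mul_le_quartic_sq (μ := lineGauss θ β) (A := qft) (B := qgt) (C := Rp) hqft4 hqgt4 hRp2 hL0
  -- ===== T6: parity under `γ` + mean transfer
  obtain ⟨hP8fI, hP8fle⟩ := integral_sub_const_pow_eight_le (μ := gaussD ⌈β ^ θ⌉₊ (dimE ρ₂)) hqfm.aestronglyMeasurable hqf8
    (∫ s, qf s ∂(lineGauss θ β))
  obtain ⟨hP8gI, hP8gle⟩ := integral_sub_const_pow_eight_le (μ := gaussD ⌈β ^ θ⌉₊ (dimE ρ₂)) hqgm.aestronglyMeasurable hqg8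
    (∫ s, qg s ∂(lineGauss θ β))
  have haf : (∫ s, qf s ∂(lineGauss θ β)) ^ 8 ≤ (1 + A4) ^ 4 := by
    have h2 : (∫ s, qf s ∂(lineGauss θ β)) ^ 2 ≤ 1 + A4 := (sq_integral_le_integral_sq hqf2ν).trans hqf2νle
    calc (∫ s, qf s ∂(lineGauss θ β)) ^ 8 = ((∫ s, qf s ∂(lineGauss θ β)) ^ 2) ^ 4 := by ring
      _ ≤ (1 + A4) ^ 4 := pow_le_pow_left₀ (sq_nonneg _) h2 4
  have hag : (∫ s, qg s ∂(lineGauss θ β)) ^ 8 ≤ (1 + A4) ^ 4 := by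
    have h2 : (∫ s, qg s ∂(lineGauss θ β)) ^ 2 ≤ 1 + A4 := (sq_integral_le_integral_sq hqg2ν).trans hqg2νle
    calc (∫ s, qg s ∂(lineGauss θ β)) ^ 8 = ((∫ s, qg s ∂(lineGauss θ β)) ^ 2) ^ 4 := by ring
      _ ≤ (1 + A4) ^ 4 := pow_le_pow_left₀ (sq_nonneg _) h2 4
  have hP8f : ∫ t, (qf t - ∫ s, qf s ∂(lineGauss θ β)) ^ 8 ∂(gaussD ⌈β ^ θ⌉₊ (dimE ρ₂)) ≤ 2 ^ 7 * (A8 + (1 + A4) ^ 4) :=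
    hP8fle.trans (by linarith only [hqf8le, haf])
  have hP8g : ∫ t, (qg t - ∫ s, qg s ∂(lineGauss θ β)) ^ 8 ∂(gaussD ⌈β ^ θ⌉₊ (dimE ρ₂)) ≤ 2 ^ 7 * (A8 + (1 + A4) ^ 4) :=
    hP8gle.trans (by linarith only [hqg8le, hag])
  -- the product `P = q̃_f q̃_g V` is odd and square integrable under `γ`
  have hY0 : Integrable (fun t => (qf t - ∫ s, qf s ∂(lineGauss θ β)) ^ 8 + (qg t - ∫ s, qg s ∂(lineGauss θ β)) ^ 8)
      (gaussD ⌈β ^ θ⌉₊ (dimE ρ₂)) := hP8fI.add hP8gI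
  have hY1 : Integrable (fun t => 1 * ((qf t - ∫ s, qf s ∂(lineGauss θ β)) ^ 8 + (qg t - ∫ s, qg s ∂(lineGauss θ β)) ^ 8) / 4)
      (gaussD ⌈β ^ θ⌉₊ (dimE ρ₂)) := (hY0.const_mul 1).div_const 4
  have hY2 : Integrable (fun t => (1 : ℝ)⁻¹ * V t ^ 4 / 2) (gaussD ⌈β ^ θ⌉₊ (dimE ρ₂)) := (hV4.const_mul _).div_const 2
  have hY : Integrable (fun t => 1 * ((qf t - ∫ s, qf s ∂(lineGauss θ β)) ^ 8 + (qg t - ∫ s, qg s ∂(lineGauss θ β)) ^ 8) / 4 +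
      (1 : ℝ)⁻¹ * V t ^ 4 / 2) (gaussD ⌈β ^ θ⌉₊ (dimE ρ₂)) := hY1.add hY2
  have hPm : AEStronglyMeasurable (fun t => qft t * qgt t * V t) (gaussD ⌈β ^ θ⌉₊ (dimE ρ₂)) :=
    ((hqftm.mul hqgtm).mul hVm).aestronglyMeasurable
  have hPpt : ∀ t, (qft t * qgt t * V t) ^ 2 ≤ 1 * ((qf t - ∫ s, qf s ∂(lineGauss θ β)) ^ 8 + (qg t - ∫ s, qg s ∂(lineGauss θ β)) ^ 8) / 4 +
      (1 : ℝ)⁻¹ * V t ^ 4 / 2 := fun t => by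
    have h := abs_mul_mul_le_quartic_sq (qft t ^ 2) (qgt t ^ 2) (V t ^ 2) one_pos
    rw [abs_of_nonneg (by positivity)] at h
    have e1 : (qft t * qgt t * V t) ^ 2 = qft t ^ 2 * qgt t ^ 2 * V t ^ 2 := by ring
    have e2 : (qft t ^ 2) ^ 4 = (qf t - ∫ s, qf s ∂(lineGauss θ β)) ^ 8 := by rw [hqft]; ring
    have e3 : (qgt t ^ 2) ^ 4 = (qg t - ∫ s, qg s ∂(lineGauss θ β)) ^ 8 := by rw [hqgt]; ring
    have e5 : (V t ^ 2) ^ 2 = V t ^ 4 := by ring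
    rw [e1]; rw [e2, e3, e5] at h; exact h
  have hP2 : Integrable (fun t => (qft t * qgt t * V t) ^ 2) (gaussD ⌈β ^ θ⌉₊ (dimE ρ₂)) :=
    hY.mono' (hPm.pow 2) (ae_of_all _ fun t => by rw [Real.norm_eq_abs, abs_of_nonneg (sq_nonneg _)]; exact hPpt t)
  have hP2m : MemLp (fun t => qft t * qgt t * V t) 2 (gaussD ⌈β ^ θ⌉₊ (dimE ρ₂)) := (memLp_two_iff_integrable_sq hPm).2 hP2
  have hP2le : ∫ t, (qft t * qgt t * V t) ^ 2 ∂(gaussD ⌈β ^ θ⌉₊ (dimE ρ₂)) ≤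
      ((∫ t, (qf t - ∫ s, qf s ∂(lineGauss θ β)) ^ 8 ∂(gaussD ⌈β ^ θ⌉₊ (dimE ρ₂))) +
        ∫ t, (qg t - ∫ s, qg s ∂(lineGauss θ β)) ^ 8 ∂(gaussD ⌈β ^ θ⌉₊ (dimE ρ₂))) / 4 +
      (∫ t, V t ^ 4 ∂(gaussD ⌈β ^ θ⌉₊ (dimE ρ₂))) / 2 := by
    refine (integral_mono hP2 hY hPpt).trans (le_of_eq ?_)
    rw [integral_add hY1 hY2, integral_div, integral_const_mul, integral_add hP8fI hP8gI, integral_div, integral_const_mul, one_mul,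
      inv_one, one_mul]
  have hPodd : ∀ t, qft (-t) * qgt (-t) * V (-t) = -(qft t * qgt t * V t) := fun t => by
    rw [hqft, hqgt]; simp only [hqfe, hqge, hVo]; ring
  have t6 : |∫ t, qft t * qgt t * V t ∂(lineGauss θ β)| ≤
      2 * (1 + (((∫ t, (qf t - ∫ s, qf s ∂(lineGauss θ β)) ^ 8 ∂(gaussD ⌈β ^ θ⌉₊ (dimE ρ₂))) +
        ∫ t, (qg t - ∫ s, qg s ∂(lineGauss θ β)) ^ 8 ∂(gaussD ⌈β ^ θ⌉₊ (dimE ρ₂))) / 4 +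
      (∫ t, V t ^ 4 ∂(gaussD ⌈β ^ θ⌉₊ (dimE ρ₂))) / 2)) * (1 / β) := by
    have h := htr β hβ₂ (fun t => qft t * qgt t * V t) hP2m
    rw [hsq, integral_gaussD_eq_zero_of_odd _ _ hPodd, zero_sub, abs_neg] at h
    refine h.trans (mul_le_mul_of_nonneg_right ?_ (by positivity))
    linarith only [hP2le]
  -- ===== bookkeeping
  have key := tilt_bookkeeping hβ1 hHr h62 h84 hA4 hA8 hCc4 hCr4 hFf2 hFf4 hQg2 hQf4 hPf4 hQg4 hPg4 hUf4 hNf4 hUg4 hNg4 hCcf hCcg hCrf hCrg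
    hV4νle hR2 hD2 hEV2 hP8f hP8g hV41 t1 t2 t3 t4 t5 t6
  rw [hsplit]
  exact (abs_add_six_le _ _ _ _ _ _).trans key

end TiltEngine

end Summit.QuantumFields.YangMills.Theorems.AllWindowsColdBoxBoxMidLine

end
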